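import Mathlib
import Literature.Probability.LatticeModels.ThermodynamicLimit
import Literature.Probability.LatticeModels.SharpnessProofs
import Summits.CriticalPhenomena.Ising3DConformalLimit.Theorems.PrecisionLaplacianDirectCorrelationStableTailRieszGaussianAux
import Summits.CriticalPhenomena.Ising3DConformalLimit.Theorems.PrecisionLaplacianDirectCorrelationStableTailRieszGaussianAux2
import Summits.CriticalPhenomena.Ising3DConformalLimit.Theorems.PrecisionLaplacianDirectCorrelationStableTailRieszGaussianAux3
import Summits.CriticalPhenomena.Ising3DConformalLimit.Theorems.PrecisionLaplacianDirectCorrelationStableTailRieszGaussianAux4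
import HarnessLib

/-!
# Stub `stub_rieszGaussian` of line `diffusive-branch-is-nonsaturation`
(crux `PrecisionLaplacian.DirectCorrelationStableTail`, item stmt-CriticalPhenomena-4799)

**The Riesz–Gaussian oscillatory integral.**  For `1 < α < 2`, `t > 0`, `k ∈ ℝ³ ∖ {0}` and
`φ_{t,k}(w) = e^{-t|w|₂²} cos(k·w)`, let

  `D(u) = ∫_{ℝ³} |v|₂^{α-3} (φ_{t,k}(v) − φ_{t,k}(v+u)) dv`

(the Gaussian-regularised Fourier transform of the Riesz kernel `|v|₂^{α-3}`; `ℝ³ = Fin 3 → ℝ`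
with the product Lebesgue measure).  We prove: there is `C_α > 0` depending on `α` only, for
`k ≠ 0` a bound `B = B(α,k)`, and for every `ε > 0` a threshold `t₀ ∈ (0,1]` such that for
`0 < t < t₀`

* (a) `|D(u) − C_α|k|₂^{-α}(1 − cos k·u)| ≤ ε` uniformly on the window `|u|₂ ≤ t^{-1/4}`;
* (b) `|D(u) − C_α|k|₂^{-α}(1 − cos k·u)| ≤ ε|u|₂²` for `|u|₂ ≤ 1` (second order at `u = 0`);
* (c) `|D(u)| ≤ B` for all `u`.

Proof (files `…RieszGaussianAux`, `…Aux2`, `…Aux3`, `…Aux4`).  With `β = (3−α)/2 ∈ (1/2, 1)`: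
1. *Subordination* `|v|₂^{α-3} = Γ(β)⁻¹∫_0^∞ s^{β-1}e^{-s|v|²}ds`, Fubini, and the Gaussian
   integral with a linear phase give `D(u) = κ ∫_0^∞ w_t(s)(1 − e^{-A_s}cos B_s) ds`,
   `κ = π^{3/2}/Γ(β)`, `w_t(s) = s^{β-1}(s+t)^{-3/2}e^{-|k|²/(4(s+t))}`, `A_s = (st/(s+t))|u|²`,
   `B_s = (s/(s+t))k·u` (`stub_rieszGaussian_auxRepresentation`).
2. `C_α := κ ∫_0^∞ s^{β-1}s^{-3/2}e^{-1/(4s)} ds > 0`; the substitution `s ↦ |k|²s` gives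
   `κ ∫ w_0 = C_α |k|₂^{-α}` (`rieszG_w0_scaling`, exponent `β − 3/2 = −α/2`).
3. `0 ≤ w_t ≤ min(L s^{β-1}, s^{β-5/2})`, an integrable dominator independent of `t`; hence (c)
   with `B = 2κ∫(dominator)`, and `∫ w_t → ∫ w_0` (`t → 0⁺`) by dominated convergence (`…Aux2`).
4. The error `D(u) − κW₀(1 − cos θ)` (`θ = k·u`) equals
   `κ∫w_t[(cos θ − cos B_s) + (1 − e^{-A_s})cos B_s] + κ(∫w_t − W₀)(1 − cos θ)`; the bounds
   `|1 − e^{-A_s}| ≤ t|u|²`, `|cos θ − cos B_s| ≤ min(2, (t/(s+t))|θ|, (t/(s+t))θ²)`, a split at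
   `s = σ` using the small mass `∫_0^σ L s^{β-1} = Lσ^β/β` (`…Aux3`), and the window algebra
   `|u|₂ ≤ t^{-1/4} ⟹ t|u|² ≤ √t, t|θ| ≤ |k|√t` (`…Aux4`) give (a) and (b) for `t` small.

This is the Fourier transform of the Riesz potential (E. M. Stein, *Singular Integrals and
Differentiability Properties of Functions* (1970), Ch. V §1, Lemma 1:
`(|x|^{α-n})^∧ = c_{n,α}|ξ|^{-α}`), in a Gaussian-regularised quantitative form; all steps are
folklore.  In the line this identifies the scaling limit of the critical Ising direct correlation
function with the isotropic `α`-stable symbol `c'|k|^α` (consumed verbatim by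
`stub_symbolIdentification`).
-/

noncomputable section

namespace Summit.CriticalPhenomena.Ising3DConformalLimit.Cruxes.DirectCorrelationStableTail.DiffusiveBranchIsNonsaturation

open MeasureTheory Filter Topology Set
open scoped BigOperators
open Literature.Probability.LatticeModels

/-- **Stub `stub_rieszGaussian`** (line `diffusive-branch-is-nonsaturation`, crux
stmt-CriticalPhenomena-4799): the Gaussian-regularised Fourier transform of the Riesz kernel
`|v|₂^{α-3}` on `ℝ³`, `1 < α < 2`.  There is `C_α > 0` (depending on `α` only) such that for `k ≠ 0`
there is `B ≥ 0`, and for every `ε > 0` a `t₀ > 0`, such that for `0 < t < t₀` the integral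
`D(u) = ∫ |v|₂^{α-3}(e^{-t|v|²}cos(k·v) − e^{-t|v+u|²}cos(k·(v+u))) dv` satisfies
(a) `|D(u) − C_α|k|₂^{-α}(1 − cos k·u)| ≤ ε` for `|u|₂ ≤ t^{-1/4}`,
(b) `|D(u) − C_α|k|₂^{-α}(1 − cos k·u)| ≤ ε|u|₂²` for `|u|₂ ≤ 1`, and (c) `|D(u)| ≤ B` for all `u`.
[folklore] -/
theorem stub_rieszGaussian :
    ∀ α : ℝ, 1 < α → α < 2 → ∃ Cα : ℝ, 0 < Cα ∧ ∀ k : Fin 3 → ℝ, k ≠ 0 → ∃ B : ℝ, 0 ≤ B ∧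
      ∀ ε : ℝ, 0 < ε → ∃ t₀ : ℝ, 0 < t₀ ∧ ∀ t : ℝ, 0 < t → t < t₀ → ∀ D : (Fin 3 → ℝ) → ℝ,
        (∀ u, D u = ∫ v : Fin 3 → ℝ, Real.sqrt (∑ i, v i ^ 2) ^ (α - 3) *
          (Real.exp (-(t * ∑ i, v i ^ 2)) * Real.cos (∑ i, k i * v i) -
            Real.exp (-(t * ∑ i, (v i + u i) ^ 2)) * Real.cos (∑ i, k i * (v i + u i)))) →
        (∀ u : Fin 3 → ℝ, Real.sqrt (∑ i, u i ^ 2) ≤ t ^ (-(1 / 4 : ℝ)) →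
          |D u - Cα * Real.sqrt (∑ i, k i ^ 2) ^ (-α) * (1 - Real.cos (∑ i, k i * u i))| ≤ ε) ∧
        (∀ u : Fin 3 → ℝ, Real.sqrt (∑ i, u i ^ 2) ≤ 1 →
          |D u - Cα * Real.sqrt (∑ i, k i ^ 2) ^ (-α) * (1 - Real.cos (∑ i, k i * u i))| ≤
            ε * ∑ i, u i ^ 2) ∧
        (∀ u : Fin 3 → ℝ, |D u| ≤ B) := by
  intro α hα1 hα2
  obtain ⟨β, hβ⟩ : ∃ β : ℝ, β = (3 - α) / 2 := ⟨_, rfl⟩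
  have hβ0 : 0 < β := by rw [hβ]; linarith
  have hβ1 : β < 3 / 2 := by rw [hβ]; linarith
  have hβh : 1 / 2 ≤ β := by rw [hβ]; linarith
  -- the universal constant `C_α = κ c₀`
  set c₀ : ℝ := ∫ s in Ioi (0 : ℝ), s ^ (β - 1) * s ^ (-(3 / 2 : ℝ)) * Real.exp (-1 / (4 * s))
    with hc₀
  have hc₀pos : 0 < c₀ := rieszG_w0_pos hβ0 hβ1 one_pos
  set κ : ℝ := Real.pi ^ (3 / 2 : ℝ) / Real.Gamma β with hκ
  have hκpos : 0 < κ := div_pos (Real.rpow_pos_of_pos Real.pi_pos _) (Real.Gamma_pos_of_pos hβ0)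
  refine ⟨κ * c₀, mul_pos hκpos hc₀pos, ?_⟩
  intro k hk
  set q : ℝ := ∑ i, k i ^ 2 with hq
  have hqpos : 0 < q := by
    rcases Function.ne_iff.1 hk with ⟨i, hi⟩
    calc (0 : ℝ) < k i ^ 2 := by
          have : k i ≠ 0 := hi
          positivity
      _ ≤ ∑ j, k j ^ 2 := Finset.single_le_sum (fun j _ => sq_nonneg (k j)) (Finset.mem_univ i)
  obtain ⟨L, hL0, hL⟩ := rieszG_profile_bound hqpos
  set Wbar : ℝ := ∫ s in Ioi (0 : ℝ), min (L * s ^ (β - 1)) (s ^ (β - 1) * s ^ (-(3 / 2 : ℝ)))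
    with hWbar
  have hWbar0 : 0 ≤ Wbar := by
    refine setIntegral_nonneg measurableSet_Ioi fun s hs => ?_
    have hs' : (0 : ℝ) < s := hs
    exact le_min (mul_nonneg hL0.le (Real.rpow_nonneg hs'.le _))
      (mul_nonneg (Real.rpow_nonneg hs'.le _) (Real.rpow_nonneg hs'.le _))
  refine ⟨2 * κ * Wbar, by positivity, ?_⟩
  intro ε hε
  -- `W₀ = ∫ w_0` and the identification `κ W₀ = C_α |k|^{-α}`
  set W₀ : ℝ := ∫ s in Ioi (0 : ℝ), s ^ (β - 1) * s ^ (-(3 / 2 : ℝ)) * Real.exp (-q / (4 * s))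
    with hW₀
  have hΛ : κ * c₀ * Real.sqrt q ^ (-α) = κ * W₀ := by
    rw [hW₀, rieszG_w0_scaling hqpos, Real.sqrt_eq_rpow, ← Real.rpow_mul hqpos.le,
      show 1 / 2 * -α = β - 3 / 2 by rw [hβ]; ring]
    ring
  -- choice of the cut-off `σ`
  have hM : 0 < κ * L / β * (2 + q) := by positivity
  obtain ⟨σ, hσ0, hσ1, hσβ⟩ := rieszG_choose_sigma hM (by positivity : 0 < ε / 3) hβh
  -- choice of `t₁` from dominated convergence
  have hδ₂ : 0 < ε / (3 * κ * (2 + q)) := by positivity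
  obtain ⟨t₁, ht₁, hclose⟩ := rieszG_eventually_close (rieszG_w_tendsto hβ0 hβ1 hqpos) hδ₂
  -- the threshold
  set τ : ℝ := ε * σ / (3 * κ * (Wbar + 1) * (Real.sqrt q + 1) ^ 2) with hτ
  have hτ0 : 0 < τ := by positivity
  refine ⟨min 1 (min t₁ (τ ^ 2)), lt_min one_pos (lt_min ht₁ (by positivity)), ?_⟩
  intro t ht htt₀ D hD
  have ht1 : t < 1 := lt_of_lt_of_le htt₀ (min_le_left _ _)
  have htt₁ : t < t₁ := lt_of_lt_of_le htt₀ ((min_le_right _ _).trans (min_le_left _ _))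
  have htτ : Real.sqrt t ≤ τ := by
    have : t < τ ^ 2 := lt_of_lt_of_le htt₀ ((min_le_right _ _).trans (min_le_right _ _))
    rw [show τ = Real.sqrt (τ ^ 2) from (Real.sqrt_sq hτ0.le).symm]
    exact Real.sqrt_le_sqrt this.le
  have htτ' : t ≤ τ := by
    refine le_trans ?_ htτ
    have hst1 : Real.sqrt t ≤ 1 := Real.sqrt_le_one.mpr ht1.le
    calc t = Real.sqrt t * Real.sqrt t := (Real.mul_self_sqrt ht.le).symm
      _ ≤ Real.sqrt t * 1 := mul_le_mul_of_nonneg_left hst1 (Real.sqrt_nonneg t)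
      _ = Real.sqrt t := mul_one _
  -- the weight `w_t`, its integral and the representation of `D`
  have hWt := rieszG_w_integral_le hβ0 hβ1 hqpos.le hL0.le hL ht.le
  have hw0 : ∀ s : ℝ, 0 < s →
      0 ≤ s ^ (β - 1) * (s + t) ^ (-(3 / 2 : ℝ)) * Real.exp (-q / (4 * (s + t))) := fun s hs =>
    (rieszG_w_le (β := β) hqpos.le hL ht.le hs).1
  have hwL : ∀ s : ℝ, 0 < s →
      s ^ (β - 1) * (s + t) ^ (-(3 / 2 : ℝ)) * Real.exp (-q / (4 * (s + t))) ≤ L * s ^ (β - 1) :=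
    fun s hs => (rieszG_w_le (β := β) hqpos.le hL ht.le hs).2.trans (min_le_left _ _)
  have hdW : |(∫ s in Ioi (0 : ℝ), s ^ (β - 1) * (s + t) ^ (-(3 / 2 : ℝ)) *
      Real.exp (-q / (4 * (s + t)))) - W₀| ≤ ε / (3 * κ * (2 + q)) := hclose t ht htt₁
  have hrepr : ∀ u : Fin 3 → ℝ, D u = κ * ∫ s in Ioi (0 : ℝ),
      s ^ (β - 1) * (s + t) ^ (-(3 / 2 : ℝ)) * Real.exp (-q / (4 * (s + t))) *
        (1 - Real.exp (-(s * t / (s + t) * ∑ i, u i ^ 2)) *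
          Real.cos (s / (s + t) * ∑ i, k i * u i)) := by
    intro u
    rw [hD u, stub_rieszGaussian_auxRepresentation α hα1 hα2 k u t ht, ← hβ]
  have hCS : ∀ u : Fin 3 → ℝ, (∑ i, k i * u i) ^ 2 ≤ q * ∑ i, u i ^ 2 := fun u =>
    Finset.sum_mul_sq_le_sq_mul_sq _ _ _
  refine ⟨?_, ?_, ?_⟩
  · -- (a) uniform convergence on the window `|u|₂ ≤ t^{-1/4}`
    intro u hu
    have hρ : 0 ≤ ∑ i, u i ^ 2 := Finset.sum_nonneg fun i _ => sq_nonneg _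
    obtain ⟨h2, h1⟩ := rieszG_window ht ht1.le hρ hqpos.le hu (hCS u)
    have core := rieszG_error_core (W₀ := W₀) (θ := ∑ i, k i * u i) hβ0 hWt.1 hw0 hwL hWt.2 ht hρ
      hσ0 zero_le_two (abs_nonneg _) (fun m _ _ => rieszG_cos_sub_cos_le_two _ m)
      (fun m _ hm1 => rieszG_cos_sub_cos_le_lin hm1)
    have harith := rieszG_arith_a hκpos hL0.le hβ0 hσ0 hσ1 hqpos hWbar0 hε (abs_nonneg _) hσβ hdW
      htτ h1 h2 (θ := ∑ i, k i * u i)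
    rw [hrepr u, hΛ, mul_assoc κ W₀ (1 - Real.cos _), ← mul_sub, abs_mul, abs_of_pos hκpos]
    exact (mul_le_mul_of_nonneg_left core hκpos.le).trans harith
  · -- (b) second order at `u = 0`
    intro u hu
    have hρ : 0 ≤ ∑ i, u i ^ 2 := Finset.sum_nonneg fun i _ => sq_nonneg _
    have hθ0 : 0 ≤ (∑ i, k i * u i) ^ 2 := sq_nonneg _
    have core := rieszG_error_core (W₀ := W₀) (θ := ∑ i, k i * u i) hβ0 hWt.1 hw0 hwL hWt.2 ht hρ
      hσ0 hθ0 hθ0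
      (fun m hm0 hm1 => (rieszG_cos_sub_cos_le_sq hm0 hm1).trans
        (mul_le_of_le_one_left hθ0 (by linarith)))
      (fun m hm0 hm1 => rieszG_cos_sub_cos_le_sq hm0 hm1)
    have harith := rieszG_arith_b hκpos hL0.le hβ0 hσ0 hσ1 hqpos hWbar0 hε (abs_nonneg _) ht hρ
      (hCS u) hσβ hdW htτ'
    rw [hrepr u, hΛ, mul_assoc κ W₀ (1 - Real.cos _), ← mul_sub, abs_mul, abs_of_pos hκpos]
    exact (mul_le_mul_of_nonneg_left core hκpos.le).trans harith
  · -- (c) the uniform bound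
    intro u
    have hρ : 0 ≤ ∑ i, u i ^ 2 := Finset.sum_nonneg fun i _ => sq_nonneg _
    rw [hrepr u, abs_mul, abs_of_pos hκpos]
    calc κ * _ ≤ κ * (2 * Wbar) :=
          mul_le_mul_of_nonneg_left (rieszG_crude_bound hWt.1 hw0 hWt.2 ht hρ) hκpos.le
      _ = 2 * κ * Wbar := by ring

end Summit.CriticalPhenomena.Ising3DConformalLimit.Cruxes.DirectCorrelationStableTail.DiffusiveBranchIsNonsaturation

end
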